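import Mathlib.Analysis.SpecificLimits.Basic
import Mathlib.Analysis.Normed.Ring.InfiniteSum
import Mathlib.Algebra.Order.Ring.GeomSum
import Summits.CriticalPhenomena.PercolationContinuityZ3.Theorems.PercNearOneGluingNoHeavyLowerTailSunflowerLSMAntidiagonal

/-!
# `NoHeavyLowerTail` (crux stmt-CriticalPhenomena-4575), abstract sunflower cubic: LOG-SUPERMODULAR SET FUNCTIONS —
# SUPERADDITIVITY OF THE GEOMETRIC (LOVÁSZ-TYPE) FUNCTIONAL (Theorem A of the memo, discrete form) and its K-player telescoping

Support file (seat `prim-ineq-prove-1` gen 35; `--supports stmt-CriticalPhenomena-4575`).  No `sorry`, no named facts.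
Memo: run/shared/lean/prim/prim-ineq-prove-1/FINDING-LSM-prove1-g35.md §2–§3.

SETTING.  `f : Finset β → ℝ` nonnegative, nondecreasing, log-supermodular; `0 ≤ q < 1`; thresholds `k : β → ℕ`.
  `Phi q f k = ∑' g, (1−q) q^g · f {i | k i ≤ g}`   (the expectation of `f` of the level set at a geometric level `g`;
for `q = c^{1/N}` and `k = N·ρ` this is `E_σ f({ρ ≤ σ})`, `σ ~ Exp`, i.e. the Lovász extension of `f` at `c^ρ`).
* `Phi_mul_Phi_le` — **THEOREM A (discrete)**: for `k, k' ≤ N ≤ k + k'` (pointwise),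
  `Phi q f k * Phi q f k' ≤ Phi q f (k + k' − N) * Phi q f N`.
  Proof: Cauchy product of the two geometric series (Step 2: the weight `(1−q)² q^{g+g'}` depends on `g + g'` only), then the
  anti-diagonal comparison `LSM.sum_antidiag_le` term by term.
* `Phi_const`: `Phi q f N = (1 − q^N) f ∅ + q^N f univ`;  `Phi_zero`: `Phi q f 0 = f univ`;  `Phi_anti`.
* `prod_Phi_le` — K-PLAYER TELESCOPING (memo Lemma 1): if every `κ i ≤ N` and every column satisfies
  `(|s|−1) N ≤ ∑_{i∈s} κ i C`, then `∏_{i∈s} Phi q f (κ i) ≤ f univ · (Phi q f N)^{|s|−1}`.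
* `tsum_geometric_indicator`: `∑' g, (1−q) q^g [M ≤ g] = q^M` (used by the next file to identify `Phi` with the share functional).
-/

namespace Summit.CriticalPhenomena.PercolationContinuityZ3.Theorems.SunflowerPartition

namespace LSM

open Finset

variable {β : Type*} [Fintype β]

/-- The geometric (Lovász-type) functional `Phi q f k = ∑' g, (1−q) q^g f {i | k i ≤ g}`. [this work] -/
noncomputable def Phi (q : ℝ) (f : Finset β → ℝ) (k : β → ℕ) : ℝ := ∑' g : ℕ, (1 - q) * q ^ g * f (lev k g)

section basic

variable {q : ℝ} {f : Finset β → ℝ}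

/-- Level sets grow with the level. [this work] -/
theorem lev_mono (k : β → ℕ) {g g' : ℕ} (h : g ≤ g') : lev k g ⊆ lev k g' := by
  intro i; simp only [lev, mem_filter, mem_univ, true_and]; exact fun hi => hi.trans h

/-- Level sets shrink with the thresholds. [this work] -/
theorem lev_anti {k k' : β → ℕ} (h : k ≤ k') (g : ℕ) : lev k' g ⊆ lev k g := by
  intro i; simp only [lev, mem_filter, mem_univ, true_and]; exact fun hi => (h i).trans hi

/-- The terms of `Phi` are nonnegative. [this work] -/
theorem term_nonneg (hq0 : 0 ≤ q) (hq1 : q < 1) (hf0 : ∀ S, 0 ≤ f S) (k : β → ℕ) (g : ℕ) :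
    0 ≤ (1 - q) * q ^ g * f (lev k g) :=
  mul_nonneg (mul_nonneg (by linarith) (pow_nonneg hq0 g)) (hf0 _)

/-- The terms of `Phi` are dominated by a geometric series. [this work] -/
theorem term_le (hq0 : 0 ≤ q) (hq1 : q < 1) (hfm : ∀ S T, S ⊆ T → f S ≤ f T) (k : β → ℕ) (g : ℕ) :
    (1 - q) * q ^ g * f (lev k g) ≤ ((1 - q) * f univ) * q ^ g := by
  have h1 : f (lev k g) ≤ f univ := hfm _ _ (subset_univ _)
  have h2 : 0 ≤ (1 - q) * q ^ g := mul_nonneg (by linarith) (pow_nonneg hq0 g)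
  calc (1 - q) * q ^ g * f (lev k g) ≤ (1 - q) * q ^ g * f univ := mul_le_mul_of_nonneg_left h1 h2
    _ = ((1 - q) * f univ) * q ^ g := by ring

variable (hq0 : 0 ≤ q) (hq1 : q < 1) (hf0 : ∀ S, 0 ≤ f S) (hfm : ∀ S T, S ⊆ T → f S ≤ f T)
include hq0 hq1 hf0 hfm

/-- Summability of the terms of `Phi`. [this work] -/
theorem summable_term (k : β → ℕ) : Summable fun g : ℕ => (1 - q) * q ^ g * f (lev k g) :=
  Summable.of_nonneg_of_le (term_nonneg hq0 hq1 hf0 k) (term_le hq0 hq1 hfm k)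
    ((summable_geometric_of_lt_one hq0 hq1).mul_left _)

/-- Summability of the norms of the terms of `Phi`. [this work] -/
theorem summable_norm_term (k : β → ℕ) : Summable fun g : ℕ => ‖(1 - q) * q ^ g * f (lev k g)‖ :=
  (summable_term hq0 hq1 hf0 hfm k).congr fun g => (Real.norm_of_nonneg (term_nonneg hq0 hq1 hf0 k g)).symm

omit hfm in
/-- `Phi` is nonnegative. [this work] -/
theorem Phi_nonneg (k : β → ℕ) : 0 ≤ Phi q f k :=
  tsum_nonneg (term_nonneg hq0 hq1 hf0 k)

/-- `Phi` is antitone in the thresholds. [this work] -/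
theorem Phi_anti {k k' : β → ℕ} (h : k ≤ k') : Phi q f k' ≤ Phi q f k := by
  unfold Phi
  refine Summable.tsum_le_tsum (fun g => ?_) (summable_term hq0 hq1 hf0 hfm k') (summable_term hq0 hq1 hf0 hfm k)
  exact mul_le_mul_of_nonneg_left (hfm _ _ (lev_anti h g)) (mul_nonneg (by linarith) (pow_nonneg hq0 g))

omit hf0 hfm in
/-- Geometric tail: `∑' g, (1−q) q^g [M ≤ g] = q^M`. [this work] -/
theorem tsum_geometric_indicator (M : ℕ) :
    ∑' g : ℕ, (1 - q) * q ^ g * (if M ≤ g then (1 : ℝ) else 0) = q ^ M := by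
  have hs : Summable fun g : ℕ => (1 - q) * q ^ g * (if M ≤ g then (1 : ℝ) else 0) := by
    refine Summable.of_nonneg_of_le (fun g => ?_) (fun g => ?_) ((summable_geometric_of_lt_one hq0 hq1).mul_left (1 - q))
    · exact mul_nonneg (mul_nonneg (by linarith) (pow_nonneg hq0 g)) (by split_ifs <;> norm_num)
    · have h2 : 0 ≤ (1 - q) * q ^ g := mul_nonneg (by linarith) (pow_nonneg hq0 g)
      calc (1 - q) * q ^ g * (if M ≤ g then (1 : ℝ) else 0) ≤ (1 - q) * q ^ g * 1 :=
            mul_le_mul_of_nonneg_left (by split_ifs <;> norm_num) h2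
        _ = (1 - q) * q ^ g := mul_one _
  rw [← hs.sum_add_tsum_nat_add M]
  have h1 : ∑ g ∈ range M, (1 - q) * q ^ g * (if M ≤ g then (1 : ℝ) else 0) = 0 := by
    refine sum_eq_zero fun g hg => ?_
    rw [mem_range] at hg
    rw [if_neg (by omega), mul_zero]
  have h2 : ∑' g : ℕ, (1 - q) * q ^ (g + M) * (if M ≤ g + M then (1 : ℝ) else 0) =
      q ^ M * ((1 - q) * ∑' g : ℕ, q ^ g) := by
    rw [← tsum_mul_left, ← tsum_mul_left]
    refine tsum_congr fun g => ?_
    rw [if_pos (by omega), pow_add]; ring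
  rw [h1, h2, tsum_geometric_of_lt_one hq0 hq1, mul_inv_cancel₀ (by linarith), zero_add, mul_one]

omit hf0 hfm in
/-- `Phi` at the constant threshold `N`: `(1 − q^N) f ∅ + q^N f univ`. [this work] -/
theorem Phi_const (N : ℕ) : Phi q f (fun _ => N) = (1 - q ^ N) * f ∅ + q ^ N * f univ := by
  have hlev : ∀ g : ℕ, lev (fun _ : β => N) g = if N ≤ g then univ else ∅ := by
    intro g; ext i; simp only [lev, mem_filter, mem_univ, true_and]
    split_ifs with h
    · simp only [mem_univ, iff_true]; exact h
    · simp only [notMem_empty, iff_false]; exact h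
  set a : ℕ → ℝ := fun g => (1 - q) * q ^ g with ha
  set b : ℕ → ℝ := fun g => (1 - q) * q ^ g * (if N ≤ g then (1 : ℝ) else 0) with hb
  have hterm : ∀ g : ℕ, (1 - q) * q ^ g * f (lev (fun _ : β => N) g) = f ∅ * (a g - b g) + f univ * b g := by
    intro g; rw [hlev g]; simp only [ha, hb]
    split_ifs <;> ring
  have hsg : Summable a := (summable_geometric_of_lt_one hq0 hq1).mul_left (1 - q)
  have hsi : Summable b := by
    refine Summable.of_nonneg_of_le (fun g => ?_) (fun g => ?_) hsg
    · exact mul_nonneg (mul_nonneg (by linarith) (pow_nonneg hq0 g)) (by split_ifs <;> norm_num)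
    · have h2 : 0 ≤ (1 - q) * q ^ g := mul_nonneg (by linarith) (pow_nonneg hq0 g)
      calc (1 - q) * q ^ g * (if N ≤ g then (1 : ℝ) else 0) ≤ (1 - q) * q ^ g * 1 :=
            mul_le_mul_of_nonneg_left (by split_ifs <;> norm_num) h2
        _ = (1 - q) * q ^ g := mul_one _
  have hsa : ∑' g, a g = 1 := by
    simp only [ha]; rw [tsum_mul_left, tsum_geometric_of_lt_one hq0 hq1, mul_inv_cancel₀ (by linarith)]
  have hsb : ∑' g, b g = q ^ N := by simp only [hb]; exact tsum_geometric_indicator hq0 hq1 N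
  unfold Phi
  rw [tsum_congr hterm]
  calc ∑' g, (f ∅ * (a g - b g) + f univ * b g)
      = ∑' g, f ∅ * (a g - b g) + ∑' g, f univ * b g := ((hsg.sub hsi).mul_left _).tsum_add (hsi.mul_left _)
    _ = f ∅ * ∑' g, (a g - b g) + f univ * ∑' g, b g := by rw [tsum_mul_left, tsum_mul_left]
    _ = f ∅ * (∑' g, a g - ∑' g, b g) + f univ * ∑' g, b g := by rw [hsg.tsum_sub hsi]
    _ = (1 - q ^ N) * f ∅ + q ^ N * f univ := by rw [hsa, hsb]; ring

omit hf0 hfm in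
/-- `Phi` at the zero threshold is `f univ`. [this work] -/
theorem Phi_zero : Phi q f (fun _ => 0) = f univ := by
  have := Phi_const hq0 hq1 (f := f) 0
  simp only [pow_zero, sub_self, zero_mul, zero_add, one_mul] at this
  exact this

end basic

/-! ## Theorem A (discrete form) -/

section theoremA

variable [DecidableEq β] {q : ℝ} (hq0 : 0 ≤ q) (hq1 : q < 1) {f : Finset β → ℝ} (hf0 : ∀ S, 0 ≤ f S)
  (hfm : ∀ S T, S ⊆ T → f S ≤ f T) (hfl : ∀ S T, f S * f T ≤ f (S ∪ T) * f (S ∩ T))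
include hq0 hq1 hf0 hfm hfl

omit [DecidableEq β] hq0 hq1 hf0 hfm hfl in
/-- The `L`-th Cauchy term of `Phi k * Phi k'`. [this work] -/
theorem cauchy_term (k k' : β → ℕ) (L : ℕ) :
    ∑ g ∈ range (L + 1), ((1 - q) * q ^ g * f (lev k g)) * ((1 - q) * q ^ (L - g) * f (lev k' (L - g))) =
      (1 - q) ^ 2 * q ^ L * ∑ g ∈ range (L + 1), f (lev k g) * f (lev k' (L - g)) := by
  rw [Finset.mul_sum]
  refine sum_congr rfl fun g hg => ?_
  rw [mem_range] at hg
  have : q ^ g * q ^ (L - g) = q ^ L := by rw [← pow_add, Nat.add_sub_cancel' (by omega)]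
  calc (1 - q) * q ^ g * f (lev k g) * ((1 - q) * q ^ (L - g) * f (lev k' (L - g)))
      = (1 - q) ^ 2 * (q ^ g * q ^ (L - g)) * (f (lev k g) * f (lev k' (L - g))) := by ring
    _ = (1 - q) ^ 2 * q ^ L * (f (lev k g) * f (lev k' (L - g))) := by rw [this]

/-- **THEOREM A (discrete).**  For nonnegative, nondecreasing, log-supermodular `f`, `0 ≤ q < 1` and thresholds
`k, k' ≤ N ≤ k + k'`:  `Phi q f k * Phi q f k' ≤ Phi q f (k + k' − N) * Phi q f N`. [this work] -/
theorem Phi_mul_Phi_le (k k' : β → ℕ) (N : ℕ) (hk : ∀ i, k i ≤ N) (hk' : ∀ i, k' i ≤ N)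
    (hkk' : ∀ i, N ≤ k i + k' i) :
    Phi q f k * Phi q f k' ≤ Phi q f (fun i => k i + k' i - N) * Phi q f (fun _ => N) := by
  unfold Phi
  rw [tsum_mul_tsum_eq_tsum_sum_range_of_summable_norm (summable_norm_term hq0 hq1 hf0 hfm k)
      (summable_norm_term hq0 hq1 hf0 hfm k'),
    tsum_mul_tsum_eq_tsum_sum_range_of_summable_norm (summable_norm_term hq0 hq1 hf0 hfm (fun i => k i + k' i - N))
      (summable_norm_term hq0 hq1 hf0 hfm (fun _ => N))]
  refine Summable.tsum_le_tsum (fun L => ?_)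
    (summable_norm_sum_mul_range_of_summable_norm (summable_norm_term hq0 hq1 hf0 hfm k)
      (summable_norm_term hq0 hq1 hf0 hfm k')).of_norm
    (summable_norm_sum_mul_range_of_summable_norm (summable_norm_term hq0 hq1 hf0 hfm (fun i => k i + k' i - N))
      (summable_norm_term hq0 hq1 hf0 hfm (fun _ => N))).of_norm
  rw [cauchy_term, cauchy_term]
  exact mul_le_mul_of_nonneg_left (sum_antidiag_le hf0 hfm hfl k k' N hk hk' hkk' L)
    (mul_nonneg (sq_nonneg _) (pow_nonneg hq0 L))

/-! ## K-player telescoping (memo Lemma 1) -/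

/-- Telescoping over a nonempty set of players: `∏_{i∈s} Phi (κ i) ≤ Phi (∑_{i∈s} κ i − (|s|−1)N) · Phi(N)^(|s|−1)`, under
`κ i ≤ N` and the column condition `(|s|−1)N ≤ ∑_{i∈s} κ i C`. [this work] -/
theorem prod_Phi_le_aux {γ : Type*} [DecidableEq γ] (κ : γ → β → ℕ) (N : ℕ) (hκ : ∀ i C, κ i C ≤ N)
    (s : Finset γ) (hs : s.Nonempty) (hcol : ∀ C, (s.card - 1) * N ≤ ∑ i ∈ s, κ i C) :
    ∏ i ∈ s, Phi q f (κ i) ≤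
      Phi q f (fun C => ∑ i ∈ s, κ i C - (s.card - 1) * N) * Phi q f (fun _ => N) ^ (s.card - 1) := by
  induction s using Finset.cons_induction with
  | empty => exact absurd hs Finset.not_nonempty_empty
  | cons j s hj ih =>
    rcases s.eq_empty_or_nonempty with hse | hsne
    · subst hse
      simp only [cons_empty, prod_singleton, sum_singleton, card_singleton, Nat.sub_self, zero_mul, Nat.sub_zero,
        pow_zero, mul_one]
      exact le_rfl
    · have hcard : (cons j s hj).card = s.card + 1 := card_cons hj
      have hcol_s : ∀ C, (s.card - 1) * N ≤ ∑ i ∈ s, κ i C := by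
        intro C
        have h1 := hcol C
        rw [sum_cons, hcard] at h1
        have h2 := hκ j C
        have hc : 1 ≤ s.card := hsne.card_pos
        have : (s.card + 1 - 1) * N = (s.card - 1) * N + N := by
          rw [Nat.add_sub_cancel, ← Nat.sub_add_cancel hc, Nat.add_mul, one_mul, Nat.add_sub_cancel]
        rw [this] at h1
        omega
      have ih' := ih hsne hcol_s
      rw [prod_cons, hcard, Nat.add_sub_cancel]
      -- apply Theorem A to the pair (κ j, accumulated threshold of s)
      set acc : β → ℕ := fun C => ∑ i ∈ s, κ i C - (s.card - 1) * N with hacc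
      have hacc_le : ∀ C, acc C ≤ N := by
        intro C
        simp only [hacc]
        have h1 : ∑ i ∈ s, κ i C ≤ ∑ i ∈ s, N := sum_le_sum fun i _ => hκ i C
        rw [sum_const, smul_eq_mul] at h1
        have hc : 1 ≤ s.card := hsne.card_pos
        have : s.card * N = (s.card - 1) * N + N := by
          rw [← Nat.sub_add_cancel hc, Nat.add_mul, one_mul, Nat.add_sub_cancel]
        omega
      have hsum : ∀ C, N ≤ κ j C + acc C := by
        intro C
        simp only [hacc]
        have h1 := hcol C
        rw [sum_cons, hcard, Nat.add_sub_cancel] at h1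
        have h3 := hcol_s C
        have hc : 1 ≤ s.card := hsne.card_pos
        have : s.card * N = (s.card - 1) * N + N := by
          rw [← Nat.sub_add_cancel hc, Nat.add_mul, one_mul, Nat.add_sub_cancel]
        omega
      have hA := Phi_mul_Phi_le hq0 hq1 hf0 hfm hfl (κ j) acc N (hκ j) hacc_le hsum
      have hnew : (fun C => κ j C + acc C - N) = fun C => ∑ i ∈ cons j s hj, κ i C - (s.card + 1 - 1) * N := by
        funext C
        simp only [hacc, sum_cons, Nat.add_sub_cancel]
        have h3 := hcol_s C
        have hc : 1 ≤ s.card := hsne.card_pos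
        have : s.card * N = (s.card - 1) * N + N := by
          rw [← Nat.sub_add_cancel hc, Nat.add_mul, one_mul, Nat.add_sub_cancel]
        omega
      have hPN : 0 ≤ Phi q f (fun _ : β => N) := Phi_nonneg hq0 hq1 hf0 _
      have hcs : s.card = s.card - 1 + 1 := (Nat.sub_add_cancel hsne.card_pos).symm
      calc Phi q f (κ j) * ∏ i ∈ s, Phi q f (κ i)
          ≤ Phi q f (κ j) * (Phi q f acc * Phi q f (fun _ => N) ^ (s.card - 1)) :=
            mul_le_mul_of_nonneg_left ih' (Phi_nonneg hq0 hq1 hf0 _)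
        _ = (Phi q f (κ j) * Phi q f acc) * Phi q f (fun _ => N) ^ (s.card - 1) := by ring
        _ ≤ (Phi q f (fun C => κ j C + acc C - N) * Phi q f (fun _ => N)) * Phi q f (fun _ => N) ^ (s.card - 1) :=
            mul_le_mul_of_nonneg_right hA (pow_nonneg hPN _)
        _ = Phi q f (fun C => κ j C + acc C - N) * Phi q f (fun _ => N) ^ (s.card - 1 + 1) := by ring
        _ = Phi q f (fun C => ∑ i ∈ cons j s hj, κ i C - (s.card + 1 - 1) * N) * Phi q f (fun _ => N) ^ s.card := by
            rw [hnew, ← hcs]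

/-- **K-player bound (memo Lemma 1 + Theorem A):** if every `κ i ≤ N` and every column satisfies
`(|s|−1) N ≤ ∑_{i∈s} κ i C`, then `∏_{i∈s} Phi q f (κ i) ≤ f univ · (Phi q f N)^(|s|−1)`. [this work] -/
theorem prod_Phi_le {γ : Type*} [DecidableEq γ] (κ : γ → β → ℕ) (N : ℕ) (hκ : ∀ i C, κ i C ≤ N)
    (s : Finset γ) (hs : s.Nonempty) (hcol : ∀ C, (s.card - 1) * N ≤ ∑ i ∈ s, κ i C) :
    ∏ i ∈ s, Phi q f (κ i) ≤ f univ * Phi q f (fun _ => N) ^ (s.card - 1) := by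
  refine (prod_Phi_le_aux hq0 hq1 hf0 hfm hfl κ N hκ s hs hcol).trans ?_
  refine mul_le_mul_of_nonneg_right ?_ (pow_nonneg (Phi_nonneg hq0 hq1 hf0 _) _)
  rw [← Phi_zero hq0 hq1 (f := f)]
  exact Phi_anti hq0 hq1 hf0 hfm fun C => Nat.zero_le _

end theoremA

end LSM

end Summit.CriticalPhenomena.PercolationContinuityZ3.Theorems.SunflowerPartition
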